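import Literature.NumberTheory.GaloisRepresentations.ArchimedeanHerbrand
import HarnessLib

/-!
# The Galois transport `E_w → E_{σw}` against the complex embeddings: the EXPLICIT criterion
# (Cassels–Fröhlich Ch. VII §1.1)

Topic `NumberTheory/GaloisRepresentations`, namespace `Literature.NumberTheory.GaloisRepresentations.ArchHerbrand`;
sequel of `ArchimedeanHerbrand` (`extensionEmbedding_galInfiniteCompletionMap`: the composite
`ι_{w'} ∘ σ_w : E_w → E_{w'} → ℂ` is EITHER `ι_w` OR `conj ∘ ι_w`). PROOFS ONLY (no definition, no named fact, no
`sorry`). This file records WHICH case holds: `ι_{w'} ∘ σ_w = ι_w` when `σ_{w'} ∘ σ = σ_w` on `E` (Mathlib's chosen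
embeddings `σ_w = w.embedding`), and `ι_{w'} ∘ σ_w = conj ∘ ι_w` when `conj ∘ σ_{w'} ∘ σ = σ_w`; one of the two always holds
(`embedding_comp_eq_or_eq_conjugate`). This is the bookkeeping needed to read the infinite coordinates of the Galois
norm `∏_σ σ • x` of an idele against embeddings — step (ii) of the plan for the infinity type of `χ.compRelNorm`
recorded in the V2 memo of crux `EisensteinHeartFlatCMInertBadKPrime` of route `BiquadraticEisensteinDescent`
(`Summits/BirchSwinnertonDyer`), which requested it.

References: [CasselsFrohlichANT1967] Ch. VII §1.1 (archimedean places under Galois transport).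
-/

noncomputable section

open scoped NumberField ComplexConjugate
open NumberField NumberField.InfinitePlace

namespace Literature.NumberTheory.GaloisRepresentations

namespace ArchHerbrand

open Literature.NumberTheory.Automorphic

variable {F : Type*} [Field F] {E : Type*} [Field E] [Algebra F E]

/-- For `σ • w = w'` the embedding `σ_{w'} ∘ σ` of `E` defines the place `w`, hence is `σ_w` or `σ̄_w`.
[cite: CasselsFrohlichANT1967, Ch. VII §1.1] -/
theorem embedding_comp_eq_or_eq_conjugate (σ : E ≃ₐ[F] E) {w w' : InfinitePlace E} (h : σ • w = w') :
    w'.embedding.comp σ.toRingEquiv.toRingHom = w.embedding ∨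
      ComplexEmbedding.conjugate (w'.embedding.comp σ.toRingEquiv.toRingHom) = w.embedding := by
  have hplace : InfinitePlace.mk (w'.embedding.comp σ.toRingEquiv.toRingHom) = InfinitePlace.mk w.embedding := by
    rw [mk_embedding, ← h]
    show InfinitePlace.mk ((σ • w).embedding.comp σ.toRingEquiv.toRingHom) = w
    conv_rhs => rw [← inv_smul_smul σ w, InfinitePlace.smul_eq_comap, ← mk_embedding (σ • w),
      InfinitePlace.comap_mk]
    rfl
  exact InfinitePlace.mk_eq_iff.mp hplace

/-- **Transport = identity on coordinates** when `σ_{w'} ∘ σ = σ_w`: `ι_{w'}(σ_w y) = ι_w(y)` for all `y ∈ E_w`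
(two continuous ring homomorphisms `E_w → ℂ` agreeing on `E`). [cite: CasselsFrohlichANT1967, Ch. VII §1.1] -/
theorem extensionEmbedding_galInfiniteCompletionMap_of_comp_eq (σ : E ≃ₐ[F] E) {w w' : InfinitePlace E}
    (h : σ • w = w') (heq : w'.embedding.comp σ.toRingEquiv.toRingHom = w.embedding) (y : w.Completion) :
    Completion.extensionEmbedding w' (galInfiniteCompletionMap σ h y) = Completion.extensionEmbedding w y := by
  have hcont₁ : Continuous fun y => Completion.extensionEmbedding w' (galInfiniteCompletionMap σ h y) :=
    (Completion.isometry_extensionEmbedding w').continuous.comp (continuous_galInfiniteCompletionMap F σ h)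
  have hcont₂ : Continuous fun y => Completion.extensionEmbedding w y :=
    (Completion.isometry_extensionEmbedding w).continuous
  refine congrFun (InfinitePlace.Completion.ext_of_coe w hcont₁ hcont₂ fun x => ?_) y
  simp only [galInfiniteCompletionMap_coe, extensionEmbedding_coe']
  exact RingHom.congr_fun heq x

/-- **Transport = complex conjugation on coordinates** when `conj ∘ σ_{w'} ∘ σ = σ_w` (i.e. `σ_{w'} ∘ σ = σ̄_w`): `ι_{w'}(σ_w y) = conj(ι_w(y))` for
all `y ∈ E_w`. [cite: CasselsFrohlichANT1967, Ch. VII §1.1] -/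
theorem extensionEmbedding_galInfiniteCompletionMap_of_comp_eq_conjugate (σ : E ≃ₐ[F] E)
    {w w' : InfinitePlace E} (h : σ • w = w')
    (heq : ComplexEmbedding.conjugate (w'.embedding.comp σ.toRingEquiv.toRingHom) = w.embedding)
    (y : w.Completion) :
    Completion.extensionEmbedding w' (galInfiniteCompletionMap σ h y) =
      starRingEnd ℂ (Completion.extensionEmbedding w y) := by
  have hcont₁ : Continuous fun y => Completion.extensionEmbedding w' (galInfiniteCompletionMap σ h y) :=
    (Completion.isometry_extensionEmbedding w').continuous.comp (continuous_galInfiniteCompletionMap F σ h)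
  have hcont₂ : Continuous fun y => Completion.extensionEmbedding w y :=
    (Completion.isometry_extensionEmbedding w).continuous
  refine congrFun (InfinitePlace.Completion.ext_of_coe w hcont₁
    (Complex.continuous_conj.comp hcont₂) fun x => ?_) y
  simp only [galInfiniteCompletionMap_coe, extensionEmbedding_coe', Function.comp_apply]
  have h1 : starRingEnd ℂ (w'.embedding (σ x)) = w.embedding x := by
    have := RingHom.congr_fun heq x
    rwa [ComplexEmbedding.conjugate_coe_eq] at this
  rw [← h1, starRingEnd_self_apply]

end ArchHerbrand

end Literature.NumberTheory.GaloisRepresentations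

end
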